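import Literature.NumberTheory.LFunctions.Zhang2022.Section8ClosedForm
import Literature.Analysis.ValidatedNumerics.TrigLogTables

/-!
# Zhang (2022) §8: kernel-checked enclosure of `𝔠₁`; the printed (8.24) is false

Trunk T-ANT (NumberTheory/LFunctions). Companion of `Section8Defs.lean` / `Section8ClosedForm.lean`
(Y. Zhang, arXiv:2211.02515v1, §8 [Zhang2022LandauSiegel]; an unrefereed manuscript whose
claimed result is under adjudication).

**Result (kernel-checked, axioms `propext`, `Classical.choice`, `Quot.sound` only).** With
`b₁₁, b₂₂, b₂₁, b₁₂, c₁₁, c₂₂, c₁₂, ι₂, 𝔠₁` exactly as printed in (8.13)–(8.23), (2.26):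

* `frakc1_re_bounds : 7.0501 < Re 𝔠₁ < 7.05011`, `frakc1_im : Im 𝔠₁ = 0`;
* hence `not_ineq824 : ¬ (𝔠₁ < 6.9955)` — the printed inequality (8.24) does not follow from
  the printed definitions. In the manuscript (8.24) is used exactly once, in §18 together with
  (9.8) `𝔠₂ < 6.9955` and (18.2) `Re 𝔠₃ < −6.9951`: "It follows from (8.24), (9.8) and (18.2)
  that `𝔠₁ + 𝔠₂ + 2Re{𝔠₃} < 0.001`", which with (8.23), (9.7), (18.1) and (8.2) is the printed
  proof of (2.32), hence of Proposition 2.5; the chain is broken at this link as printed (the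
  printed bounds (9.8), (18.2) give only `𝔠₁ + 𝔠₂ + 2Re{𝔠₃} < 𝔠₁ − 6.9947`, so `< 0.001`
  would need `𝔠₁ < 6.9957`, while `Re 𝔠₁ > 7.0501`; the companion file `Section18Defs.lean`
  transcribes `𝔠₂`, `𝔠₃` and that final inequality);
* the individual constants: `c11_re_bounds : 3.612261 < c₁₁ < 3.612262` (printed `3.61226`,
  agrees), `c22_re_bounds : 1.322149 < c₂₂ < 1.32215` (printed `1.32215`, agrees),
  `c12_re_bounds : −0.457472 < Re c₁₂ < −0.457471` (printed `−0.45757`, off by `1.0·10⁻⁴`),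
  `c12_im_bounds : −0.201384 < Im c₁₂ < −0.201383` (printed `−0.18179`, off by `1.96·10⁻²`);
* `ineq824_of_printed_constants`: the printed decimal values of `c₁₁, c₂₂, c₁₂` DO give
  `𝔠₁ ≈ 6.99545 < 6.9955`, so the discrepancy is located in the printed value of `Im c₁₂`
  (equivalently of `Im b₁₂ − Im b₂₁`), not in the assembly (8.23).

No claim is made here about whether the manuscript's argument can be repaired (e.g. by another
choice of `ι₂` or of the mollifier parameters); that is a separate computation.

**Method.** `Section8ClosedForm` reduces the four integrals to finitely many operations
`+, −, ×, conj` on rationals, `π`, `1/π` and `e^{θπi}` (`θ ∈ ℚ`). This file mirrors each closed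
form by a box computation in the verified fixed-point interval engine
`Literature.Analysis.ValidatedNumerics.FixedPointInterval` (scale `2^48`; `FI.pi`, `CB.expI`,
outward-rounded ring operations, each with a `mem` soundness lemma), proves
`mem_frakc1 : frakc1 ∈ frakc1B` by composing those lemmas (`apply_rules`), and has the kernel
evaluate the ten endpoint comparisons `cert : CertProp` by `decide +kernel`. Resulting
enclosure widths are about `10⁻⁸`. Independent cross-check (not part of the proof): adaptive
quadrature and exact antiderivatives in double precision give `𝔠₁ = 7.05010466979…`,
`c₁₂ = −0.45747157872 − 0.20138343543 i`.
-/

noncomputable section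

open Complex Real ComplexConjugate
open Literature.Analysis.ValidatedNumerics.Numerics

namespace Literature.NumberTheory.LFunctions.Zhang2022

/-! ### Interval-arithmetic enclosures (engine `Literature.Analysis.ValidatedNumerics`) -/

/-- box of a rational constant [folklore] -/
def qCB (q : ℚ) : CB := CB.ofFI (FI.ofRat q)

/-- `(q : ℂ) ∈ qCB q`. [folklore] -/
theorem mem_qCB (q : ℚ) : CB.mem (q : ℂ) (qCB q) := by
  have h := CB.mem_ofFI (FI.mem_ofRat q)
  rwa [Complex.ofReal_ratCast] at h

/-- `0 ∈ CB.ofInt 0`. [folklore] -/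
theorem mem_zeroCB : CB.mem (0 : ℂ) (CB.ofInt 0) := by simpa using CB.mem_ofInt 0
/-- `1 ∈ CB.ofInt 1`. [folklore] -/
theorem mem_oneCB : CB.mem (1 : ℂ) (CB.ofInt 1) := by simpa using CB.mem_ofInt 1

/-- enclosure of `θπ` for rational `θ` [folklore] -/
def piMul (θ : ℚ) : FI := (FI.pi.mulInt θ.num).divNat θ.den

/-- `θπ ∈ piMul θ`. [folklore] -/
theorem mem_piMul (θ : ℚ) : FI.mem ((θ : ℝ) * π) (piMul θ) := by
  have h := FI.mem_divNat (FI.mem_mulInt FI.mem_pi θ.num) θ.den_pos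
  have e : π * (θ.num : ℝ) / (θ.den : ℝ) = (θ : ℝ) * π := by
    rw [Rat.cast_def θ]; ring
  rw [e] at h; exact h

/-- enclosure of `e^{θπi}` for rational `θ` (junk if the flag `expIpiOK θ` is false) [folklore] -/
def expIpi (θ : ℚ) : CB := (CB.expI (piMul θ)).getD (CB.ofInt 0)
/-- validity flag for `expIpi` [folklore] -/
def expIpiOK (θ : ℚ) : Bool := (CB.expI (piMul θ)).isSome

/-- `e^{θπi} ∈ expIpi θ` whenever the validity flag is set. [folklore] -/
theorem mem_expIpi {θ : ℚ} (h : expIpiOK θ = true) :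
    CB.mem (cexp ((((θ : ℝ) * π : ℝ) : ℂ) * I)) (expIpi θ) := by
  unfold expIpiOK at h
  unfold expIpi
  cases hY : CB.expI (piMul θ) with
  | none => rw [hY] at h; simp at h
  | some Y => simpa using CB.mem_expI hY (mem_piMul θ)

/-- enclosure of `q/π` (junk if the flag is false) [folklore] -/
def overPiFI (q : ℚ) : FI := (FI.divPos (FI.ofRat q) FI.pi).getD (FI.ofInt 0)
/-- validity flag for `overPiFI` [folklore] -/
def overPiOK (q : ℚ) : Bool := (FI.divPos (FI.ofRat q) FI.pi).isSome

/-- `q/π ∈ overPiFI q` whenever the validity flag is set. [folklore] -/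
theorem mem_overPiFI {q : ℚ} (h : overPiOK q = true) : FI.mem (overPi q) (overPiFI q) := by
  unfold overPiOK at h
  unfold overPiFI overPi
  cases hK : FI.divPos (FI.ofRat q) FI.pi with
  | none => rw [hK] at h; simp at h
  | some K => simpa using FI.mem_divPos hK (FI.mem_ofRat q) FI.mem_pi

/-- box of `(πi)² = -π²` [folklore] -/
def piISq : CB := CB.ofFI ((FI.pi.mul FI.pi).neg)

/-- `(πi)² ∈ piISq`. [folklore] -/
theorem mem_piISq : CB.mem (((π : ℂ) * I) ^ 2) piISq := by
  have h := CB.mem_ofFI (FI.mem_neg (FI.mem_mul FI.mem_pi FI.mem_pi))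
  have e : (((-(π * π) : ℝ)) : ℂ) = ((π : ℂ) * I) ^ 2 := by
    push_cast; linear_combination (-(π : ℂ) ^ 2) * Complex.I_sq
  rw [e] at h; exact h

/- Keep the interval primitives opaque to the elaborator's unifier: the `mem` lemmas are applied
purely syntactically (`apply_rules`), and unfolding the boxes would make failed unification
attempts evaluate the numerics symbolically. The kernel (`decide +kernel`) is unaffected. -/
attribute [local irreducible] CB.add CB.sub CB.mul CB.neg CB.conj CB.mulFI CB.mulI CB.mulInt
  CB.ofFI CB.ofInt CB.normSqFI CB.expI FI.add FI.sub FI.mul FI.neg FI.mulInt FI.divNat FI.divPos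
  FI.ofRat FI.ofInt FI.pi qCB piMul expIpi overPiFI piISq

/-- box mirror of `P0` [folklore] -/
@[irreducible] def P0B (Q0 Q1 Q2 : CB) (U : FI) : CB :=
  (((Q0.mulFI U).mulI).neg).add
    ((Q1.mulFI (U.mul U)).add (((Q2.mulFI ((U.mul U).mul U)).mulI).mulInt 2))
/-- box mirror of `P1` [folklore] -/
@[irreducible] def P1B (Q1 Q2 : CB) (U : FI) : CB := (((Q1.mulFI U).mulI).neg).add ((Q2.mulFI (U.mul U)).mulInt 2)
/-- box mirror of `P2` [folklore] -/
@[irreducible] def P2B (Q2 : CB) (U : FI) : CB := ((Q2.mulFI U).mulI).neg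
/-- box mirror of `Pz` [folklore] -/
@[irreducible] def PzB (Q0 Q1 Q2 : CB) (U Z : FI) : CB :=
  ((P0B Q0 Q1 Q2 U).add ((P1B Q1 Q2 U).mulFI Z)).add ((P2B Q2 U).mulFI (Z.mul Z))
/-- box mirror of `expQuadInt` [folklore] -/
@[irreducible] def expQuadIntB (Q0 Q1 Q2 : CB) (m L : ℚ) : CB :=
  ((PzB Q0 Q1 Q2 (overPiFI m⁻¹) (FI.ofRat L)).mul (expIpi (m * L))).sub (P0B Q0 Q1 Q2 (overPiFI m⁻¹))
/-- box mirror of `polyInt` [folklore] -/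
@[irreducible] def polyIntB (Q0 Q1 Q2 : CB) (L : FI) : CB :=
  ((Q0.mulFI L).add ((Q1.mulFI (L.mul L)).mulFI (FI.ofRat (1/2)))).add
    ((Q2.mulFI ((L.mul L).mul L)).mulFI (FI.ofRat (1/3)))

/-- Soundness of the box mirror of `expQuadInt` (given boxes for the coefficients and the two flags). [folklore] -/
theorem mem_expQuadIntB {q0 q1 q2 : ℂ} {Q0 Q1 Q2 : CB} {m L : ℚ}
    (h0 : CB.mem q0 Q0) (h1 : CB.mem q1 Q1) (h2 : CB.mem q2 Q2)
    (hE : expIpiOK (m * L) = true) (hU : overPiOK m⁻¹ = true) :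
    CB.mem (expQuadInt q0 q1 q2 m L) (expQuadIntB Q0 Q1 Q2 m L) := by
  have hu := mem_overPiFI hU
  have he := mem_expIpi hE
  rw [show (((m * L : ℚ) : ℝ) * π : ℝ) = (m : ℝ) * (L : ℝ) * π by push_cast; ring] at he
  have hP0 : CB.mem (P0 q0 q1 q2 (overPi m⁻¹)) (P0B Q0 Q1 Q2 (overPiFI m⁻¹)) := by
    unfold P0 P0B
    apply_rules [CB.mem_add, CB.mem_mul, CB.mem_neg, CB.mem_mulI, CB.mem_mulFI,
      CB.mem_mulInt, FI.mem_mul]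
  have hP1 : CB.mem (P1 q1 q2 (overPi m⁻¹)) (P1B Q1 Q2 (overPiFI m⁻¹)) := by
    unfold P1 P1B
    apply_rules [CB.mem_add, CB.mem_mul, CB.mem_neg, CB.mem_mulI, CB.mem_mulFI,
      CB.mem_mulInt, FI.mem_mul]
  have hP2 : CB.mem (P2 q2 (overPi m⁻¹)) (P2B Q2 (overPiFI m⁻¹)) := by
    unfold P2 P2B
    apply_rules [CB.mem_neg, CB.mem_mulI, CB.mem_mulFI]
  unfold expQuadInt expQuadIntB Pz PzB
  apply_rules [CB.mem_add, CB.mem_sub, CB.mem_mul, CB.mem_mulFI, FI.mem_mul, FI.mem_ofRat]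

/-- Soundness of the box mirror of `polyInt`. [folklore] -/
theorem mem_polyIntB {q0 q1 q2 : ℂ} {Q0 Q1 Q2 : CB} (L : ℚ)
    (h0 : CB.mem q0 Q0) (h1 : CB.mem q1 Q1) (h2 : CB.mem q2 Q2) :
    CB.mem (polyInt q0 q1 q2 L) (polyIntB Q0 Q1 Q2 (FI.ofRat L)) := by
  unfold polyInt polyIntB
  apply_rules [CB.mem_add, CB.mem_mulFI, FI.mem_mul, FI.mem_ofRat]

/-- box mirror of `FGint` [folklore] -/
@[irreducible] def FGintB (a k r0 r1 b L : ℚ) : CB :=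
  (expQuadIntB (qCB r0) ((((qCB r0).mul (qCB a)).mulFI FI.pi).mulI) (CB.ofInt 0) k L).add
    (polyIntB (qCB r1) (((((qCB a).mul (qCB r1)).add (qCB b)).mulFI FI.pi).mulI)
      (((qCB a).mul (qCB b)).mul piISq) (FI.ofRat L))

/-- Soundness of the box mirror of `FGint`. [folklore] -/
theorem mem_FGintB {a k r0 r1 b L : ℚ} (hE : expIpiOK (k * L) = true) (hU : overPiOK k⁻¹ = true) :
    CB.mem (FGint a k r0 r1 b L) (FGintB a k r0 r1 b L) := by
  unfold FGint FGintB
  apply_rules [mem_expQuadIntB, mem_polyIntB, CB.mem_add, CB.mem_mul, CB.mem_mulI, CB.mem_mulFI,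
    FI.mem_pi, mem_qCB, mem_zeroCB, mem_piISq]

/-- box of `r₁ + bπis` [folklore] -/
@[irreducible] def shiftRB (r1 b s : ℚ) : CB := (qCB r1).add ((((qCB b).mulFI FI.pi).mulI).mulFI (FI.ofRat s))
/-- box of `1 + aπis` [folklore] -/
@[irreducible] def shiftUB (a s : ℚ) : CB := (CB.ofInt 1).add ((((qCB a).mulFI FI.pi).mulI).mulFI (FI.ofRat s))

/-- `r₁ + bπis ∈ shiftRB r₁ b s`. [folklore] -/
theorem mem_shiftRB (r1 b s : ℚ) : CB.mem ((r1 : ℂ) + b * π * I * (s : ℝ)) (shiftRB r1 b s) := by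
  unfold shiftRB
  apply_rules [CB.mem_add, CB.mem_mulI, CB.mem_mulFI, FI.mem_pi, FI.mem_ofRat, mem_qCB]

/-- `1 + aπis ∈ shiftUB a s`. [folklore] -/
theorem mem_shiftUB (a s : ℚ) : CB.mem ((1 : ℂ) + a * π * I * (s : ℝ)) (shiftUB a s) := by
  unfold shiftUB
  apply_rules [CB.mem_add, CB.mem_mulI, CB.mem_mulFI, FI.mem_pi, FI.mem_ofRat, mem_qCB, mem_oneCB]

/-- box mirror of `FGXint` [folklore] -/
@[irreducible] def FGXintB (a k r0 r1 b k' L s : ℚ) : CB :=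
  (expQuadIntB (qCB r0) ((((qCB r0).mul (qCB a)).mulFI FI.pi).mulI) (CB.ofInt 0) k L).add
    ((expIpi (-k' * s)).mul
      (expQuadIntB (shiftRB r1 b s) (((((qCB a).mul (shiftRB r1 b s)).add (qCB b)).mulFI FI.pi).mulI)
        (((qCB a).mul (qCB b)).mul piISq) (k - k') L))

/-- Soundness of the box mirror of `FGXint`. [folklore] -/
theorem mem_FGXintB {a k r0 r1 b k' L s : ℚ} (hE : expIpiOK (k * L) = true)
    (hU : overPiOK k⁻¹ = true) (hE' : expIpiOK ((k - k') * L) = true)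
    (hU' : overPiOK (k - k')⁻¹ = true) (hS : expIpiOK (-k' * s) = true) :
    CB.mem (FGXint a k r0 r1 b k' L s) (FGXintB a k r0 r1 b k' L s) := by
  have hs := mem_expIpi hS
  rw [show (((-k' * s : ℚ) : ℝ) * π : ℝ) = (-(k' : ℝ)) * (s : ℝ) * π by push_cast; ring] at hs
  have hR := mem_shiftRB r1 b s
  unfold FGXint FGXintB
  apply_rules [mem_expQuadIntB, CB.mem_add, CB.mem_mul, CB.mem_mulI, CB.mem_mulFI,
    FI.mem_pi, mem_qCB, mem_zeroCB, mem_piISq]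

/-- box mirror of `FGYint` [folklore] -/
@[irreducible] def FGYintB (a k r0 r1 b k' L s : ℚ) : CB :=
  (expIpi (k * s)).mul
    ((expQuadIntB ((qCB r0).mul (shiftUB a s)) ((((qCB r0).mul (qCB a)).mulFI FI.pi).mulI)
        (CB.ofInt 0) k L).add
      (expQuadIntB ((shiftUB a s).mul (qCB r1))
        (((((shiftUB a s).mul (qCB b)).add ((qCB a).mul (qCB r1))).mulFI FI.pi).mulI)
        (((qCB a).mul (qCB b)).mul piISq) (k - k') L))

/-- Soundness of the box mirror of `FGYint`. [folklore] -/
theorem mem_FGYintB {a k r0 r1 b k' L s : ℚ} (hE : expIpiOK (k * L) = true)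
    (hU : overPiOK k⁻¹ = true) (hE' : expIpiOK ((k - k') * L) = true)
    (hU' : overPiOK (k - k')⁻¹ = true) (hS : expIpiOK (k * s) = true) :
    CB.mem (FGYint a k r0 r1 b k' L s) (FGYintB a k r0 r1 b k' L s) := by
  have hs := mem_expIpi hS
  rw [show (((k * s : ℚ) : ℝ) * π : ℝ) = (k : ℝ) * (s : ℝ) * π by push_cast; ring] at hs
  have hUm := mem_shiftUB a s
  unfold FGYint FGYintB
  apply_rules [mem_expQuadIntB, CB.mem_add, CB.mem_mul, CB.mem_mulI, CB.mem_mulFI,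
    FI.mem_pi, mem_qCB, mem_zeroCB, mem_piISq]

/-- box of `b₁₁` [folklore] -/
@[irreducible] def b11B : CB :=
  ((((qCB (1/2)).mul (FGintB (1/2) (3/2) (8/3) (-5/3) (-1/2) (63/125))).add
    ((qCB 2).mul (FGintB (-1/2) (3/2) (4/3) (-1/3) (1/2) (63/125)))).add
    ((qCB (3/2)).mul (FGintB (-3/2) (3/2) (8/9) (1/9) (1/6) (63/125)))).mulFI
  (overPiFI (15625/3969))

/-- `b₁₁ ∈ b11B` (via the closed form `b11_eq`; the flags are checked by `decide`). [folklore] -/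
theorem mem_b11 : CB.mem b11 b11B := by
  have h1 : expIpiOK (3/2 * (63/125)) = true := by decide +kernel
  have h2 : overPiOK (3/2)⁻¹ = true := by decide +kernel
  have h3 : overPiOK (15625/3969) = true := by decide +kernel
  have hp := mem_overPiFI h3
  rw [b11_eq]; unfold b11val b11B
  apply_rules [mem_FGintB, CB.mem_add, CB.mem_mul, CB.mem_mulFI, mem_qCB]

/-- box of `b₂₂` [folklore] -/
@[irreducible] def b22B : CB :=
  ((((qCB (1/2)).mul (FGintB (3/2) (5/2) (24/25) (1/25) (1/10) (1/2))).add
    ((qCB 2).mul (FGintB (1/2) (5/2) (12/25) (13/25) (3/10) (1/2)))).add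
    ((qCB (3/2)).mul (FGintB (-1/2) (5/2) (8/25) (17/25) (-3/10) (1/2)))).mulFI
  (overPiFI 4)

/-- `b₂₂ ∈ b22B`. [folklore] -/
theorem mem_b22 : CB.mem b22 b22B := by
  have h1 : expIpiOK (5/2 * (1/2)) = true := by decide +kernel
  have h2 : overPiOK (5/2)⁻¹ = true := by decide +kernel
  have h3 : overPiOK 4 = true := by decide +kernel
  have hp := mem_overPiFI h3
  rw [b22_eq]; unfold b22val b22B
  apply_rules [mem_FGintB, CB.mem_add, CB.mem_mul, CB.mem_mulFI, mem_qCB]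

/-- box of `b₂₁` [folklore] -/
@[irreducible] def b21B : CB :=
  ((((qCB (1/2)).mul (FGXintB (3/2) (5/2) (8/3) (-5/3) (-1/2) (3/2) (1/2) (1/250))).add
    ((qCB 2).mul (FGXintB (1/2) (5/2) (4/3) (-1/3) (1/2) (3/2) (1/2) (1/250)))).add
    ((qCB (3/2)).mul (FGXintB (-1/2) (5/2) (8/9) (1/9) (1/6) (3/2) (1/2) (1/250)))).mulFI
  (overPiFI (250/63))

/-- `b₂₁ ∈ b21B`. [folklore] -/
theorem mem_b21 : CB.mem b21 b21B := by
  have h1 : expIpiOK (5/2 * (1/2)) = true := by decide +kernel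
  have h2 : overPiOK (5/2)⁻¹ = true := by decide +kernel
  have h3 : expIpiOK ((5/2 - 3/2) * (1/2)) = true := by decide +kernel
  have h4 : overPiOK (5/2 - 3/2)⁻¹ = true := by decide +kernel
  have h5 : expIpiOK (-(3/2) * (1/250)) = true := by decide +kernel
  have h6 : overPiOK (250/63) = true := by decide +kernel
  have hp := mem_overPiFI h6
  rw [b21_eq]; unfold b21val b21B
  apply_rules [mem_FGXintB, CB.mem_add, CB.mem_mul, CB.mem_mulFI, mem_qCB]

/-- box of `b₁₂` [folklore] -/
@[irreducible] def b12B : CB :=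
  ((((qCB (1/2)).mul (FGYintB (1/2) (3/2) (24/25) (1/25) (1/10) (5/2) (1/2) (1/250))).add
    ((qCB 2).mul (FGYintB (-1/2) (3/2) (12/25) (13/25) (3/10) (5/2) (1/2) (1/250)))).add
    ((qCB (3/2)).mul (FGYintB (-3/2) (3/2) (8/25) (17/25) (-3/10) (5/2) (1/2) (1/250)))).mulFI
  (overPiFI (250/63))

/-- `b₁₂ ∈ b12B`. [folklore] -/
theorem mem_b12 : CB.mem b12 b12B := by
  have h1 : expIpiOK (3/2 * (1/2)) = true := by decide +kernel
  have h2 : overPiOK (3/2)⁻¹ = true := by decide +kernel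
  have h3 : expIpiOK ((3/2 - 5/2) * (1/2)) = true := by decide +kernel
  have h4 : overPiOK (3/2 - 5/2)⁻¹ = true := by decide +kernel
  have h5 : expIpiOK (3/2 * (1/250)) = true := by decide +kernel
  have h6 : overPiOK (250/63) = true := by decide +kernel
  have hp := mem_overPiFI h6
  rw [b12_eq]; unfold b12val b12B
  apply_rules [mem_FGYintB, CB.mem_add, CB.mem_mul, CB.mem_mulFI, mem_qCB]

/-- box of `ι₂` [folklore] -/
@[irreducible] def iota2B : CB := (qCB 0.94977).sub ((qCB 1.38995).mulI)

/-- `ι₂ ∈ iota2B`. [folklore] -/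
theorem mem_iota2 : CB.mem iota2 iota2B := by
  have e : iota2 = ((0.94977 : ℚ) : ℂ) - ((1.38995 : ℚ) : ℂ) * I := by
    unfold iota2; push_cast; rfl
  rw [e]; unfold iota2B
  apply_rules [CB.mem_sub, CB.mem_mulI, mem_qCB]

/-- boxes of `c₁₁, c₂₂, c₁₂, c₂₁, 𝔠₁` [folklore] -/
@[irreducible] def c11B : CB := b11B.add b11B.conj
/-- see `c11B` [folklore] -/
@[irreducible] def c22B : CB := b22B.add b22B.conj
/-- see `c11B` [folklore] -/
@[irreducible] def c12B : CB := b12B.add b21B.conj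
/-- see `c11B` [folklore] -/
@[irreducible] def c21B : CB := c12B.conj
/-- see `c11B` [folklore] -/
@[irreducible] def frakc1B : CB :=
  ((c11B.add (iota2B.mul c21B)).add (iota2B.conj.mul c12B)).add ((CB.ofFI iota2B.normSqFI).mul c22B)

/-- `c₁₁ ∈ c11B`. [folklore] -/
theorem mem_c11 : CB.mem c11 c11B := by
  unfold c11 c11B; apply_rules [CB.mem_add, CB.mem_conj, mem_b11]
/-- `c₂₂ ∈ c22B`. [folklore] -/
theorem mem_c22 : CB.mem c22 c22B := by
  unfold c22 c22B; apply_rules [CB.mem_add, CB.mem_conj, mem_b22]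
/-- `c₁₂ ∈ c12B`. [folklore] -/
theorem mem_c12 : CB.mem c12 c12B := by
  unfold c12 c12B; apply_rules [CB.mem_add, CB.mem_conj, mem_b12, mem_b21]
/-- `c₂₁ ∈ c21B`. [folklore] -/
theorem mem_c21 : CB.mem c21 c21B := by
  unfold c21 c21B; apply_rules [CB.mem_conj, mem_c12]
/-- **`𝔠₁ ∈ frakc1B`**: the printed constant lies in the computed box. [folklore] -/
theorem mem_frakc1 : CB.mem frakc1 frakc1B := by
  unfold frakc1 frakc1B
  apply_rules [CB.mem_add, CB.mem_mul, CB.mem_conj, CB.mem_ofFI, CB.mem_normSqFI, mem_iota2,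
    mem_c11, mem_c22, mem_c12, mem_c21]

/-! ### Certificate -/

/-- From an enclosure and a rational threshold below the box: a strict lower bound. [folklore] -/
theorem lo_bound {x : ℝ} {X : FI} (hx : FI.mem x X) {q : ℚ} (h : q * (SC : ℚ) < (X.lo : ℚ)) :
    (q : ℝ) < x := by
  have h1 : (q : ℝ) * SC < (X.lo : ℝ) := by exact_mod_cast h
  have h3 : (q : ℝ) < (X.lo : ℝ) / SC := by rw [lt_div_iff₀ SC_pos]; exact h1
  exact h3.trans_le (FI.lo_div_le hx)

/-- From an enclosure and a rational threshold above the box: a strict upper bound. [folklore] -/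
theorem hi_bound {x : ℝ} {X : FI} (hx : FI.mem x X) {q : ℚ} (h : (X.hi : ℚ) < q * (SC : ℚ)) :
    x < (q : ℝ) := by
  have h1 : (X.hi : ℝ) < (q : ℝ) * SC := by exact_mod_cast h
  have h3 : (X.hi : ℝ) / SC < q := by rw [div_lt_iff₀ SC_pos]; exact h1
  exact (FI.le_hi_div hx).trans_lt h3

/-- The comparisons read off the boxes (thresholds `q·2^48` against the integer endpoints). [folklore] -/
def CertProp : Prop :=
  ((7.0501 : ℚ) * (SC : ℚ) < (frakc1B.re.lo : ℚ) ∧ (frakc1B.re.hi : ℚ) < (7.05011 : ℚ) * (SC : ℚ))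
  ∧ ((3.612261 : ℚ) * (SC : ℚ) < (c11B.re.lo : ℚ) ∧ (c11B.re.hi : ℚ) < (3.612262 : ℚ) * (SC : ℚ))
  ∧ ((1.322149 : ℚ) * (SC : ℚ) < (c22B.re.lo : ℚ) ∧ (c22B.re.hi : ℚ) < (1.32215 : ℚ) * (SC : ℚ))
  ∧ ((-0.457472 : ℚ) * (SC : ℚ) < (c12B.re.lo : ℚ) ∧ (c12B.re.hi : ℚ) < (-0.457471 : ℚ) * (SC : ℚ))
  ∧ ((-0.201384 : ℚ) * (SC : ℚ) < (c12B.im.lo : ℚ) ∧ (c12B.im.hi : ℚ) < (-0.201383 : ℚ) * (SC : ℚ))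

/-- Decidability of the certificate comparisons. [folklore] -/
instance : Decidable CertProp := by unfold CertProp; infer_instance

/-- **The kernel check.** [folklore] -/
theorem cert : CertProp := by decide +kernel

/-- **`7.0501 < Re 𝔠₁ < 7.05011`** (true value `7.0501046…`). [folklore] -/
theorem frakc1_re_bounds : (7.0501 : ℝ) < frakc1.re ∧ frakc1.re < 7.05011 := by
  have h := cert.1
  constructor
  · exact_mod_cast lo_bound mem_frakc1.1 h.1
  · exact_mod_cast hi_bound mem_frakc1.1 h.2

/-- `3.612261 < Re c₁₁ < 3.612262` (printed: `3.61226`; consistent). [folklore] -/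
theorem c11_re_bounds : (3.612261 : ℝ) < c11.re ∧ c11.re < 3.612262 := by
  have h := cert.2.1
  exact ⟨by exact_mod_cast lo_bound mem_c11.1 h.1, by exact_mod_cast hi_bound mem_c11.1 h.2⟩

/-- `1.322149 < Re c₂₂ < 1.32215` (printed: `1.32215`; consistent). [folklore] -/
theorem c22_re_bounds : (1.322149 : ℝ) < c22.re ∧ c22.re < 1.32215 := by
  have h := cert.2.2.1
  exact ⟨by exact_mod_cast lo_bound mem_c22.1 h.1, by exact_mod_cast hi_bound mem_c22.1 h.2⟩

/-- `−0.457472 < Re c₁₂ < −0.457471` (printed: `−0.45757`; differs by `1.0·10⁻⁴`). [folklore] -/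
theorem c12_re_bounds : (-0.457472 : ℝ) < c12.re ∧ c12.re < -0.457471 := by
  have h := cert.2.2.2.1
  exact ⟨by simpa using lo_bound mem_c12.1 h.1, by simpa using hi_bound mem_c12.1 h.2⟩

/-- `−0.201384 < Im c₁₂ < −0.201383` (printed: `−0.18179`; differs by `1.96·10⁻²`). [folklore] -/
theorem c12_im_bounds : (-0.201384 : ℝ) < c12.im ∧ c12.im < -0.201383 := by
  have h := cert.2.2.2.2
  exact ⟨by simpa using lo_bound mem_c12.2 h.1, by simpa using hi_bound mem_c12.2 h.2⟩

/-- `c₁₁` is real. [folklore] -/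
theorem c11_im : c11.im = 0 := by simp [c11]
/-- `c₂₂` is real. [folklore] -/
theorem c22_im : c22.im = 0 := by simp [c22]
/-- `𝔠₁` is real. [folklore] -/
theorem frakc1_im : frakc1.im = 0 := by
  simp [frakc1, c11, c22, c21, Complex.mul_im]; ring

/-- **(8.24) is false as printed**: `𝔠₁ = 7.05010… > 6.9955`. [folklore] -/
theorem not_ineq824 : ¬ Ineq824 := by
  unfold Ineq824
  have h := frakc1_re_bounds.1
  intro h'
  linarith

/-- The printed constants do give (8.24): with `c₁₁ = 3.61226`, `c₂₂ = 1.32215`,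
`c₁₂ = −0.45757 − 0.18179i` one gets `𝔠₁ ≈ 6.99545 < 6.9955`; the slip is in `Im c₁₂`. [folklore] -/
theorem ineq824_of_printed_constants :
    (3.61226 : ℝ) + 2 * (0.94977 * (-0.45757) + 1.38995 * 0.18179)
      + (0.94977 ^ 2 + 1.38995 ^ 2) * 1.32215 < 6.9955 := by
  norm_num

end Literature.NumberTheory.LFunctions.Zhang2022

/-! ## `_holds` aliases (appended 2026-08-28, flt-inv gen 65)

The named fact(s) below are already theorems of THIS file under another name; the alias records the
discharge under the tree's exact naming convention `X_holds` (D-0026 bookkeeping: the proof term is the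
existing theorem; no statement, definition or attribute is edited; no new named fact).  The ledger's debt
table listed each as unproved (`ledger fact claim` GRANTED «status unproved», 2026-08-28T08:5xZ). -/

/-- `CertProp` — the kernel certificate of the §8 enclosure of `𝔠₁` ((8.13)–(8.23), (2.26); the printed (8.24) evaluated) holds (`decide +kernel`) (`Literature.NumberTheory.LFunctions.Zhang2022.cert`). [cite: Zhang2022LandauSiegel, §8 (8.13)–(8.24)] -/
theorem _root_.Literature.NumberTheory.LFunctions.Zhang2022.CertProp_holds : _root_.Literature.NumberTheory.LFunctions.Zhang2022.CertProp :=
  _root_.Literature.NumberTheory.LFunctions.Zhang2022.cert
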